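import Summits.AtomisticToContinuum.Crystallization.Theses.BraggSlacknessRigidity

/-!
# Route `BraggSlacknessRigidity`, item `StrictImpliesExact` (stmt-AtomisticToContinuum-13169)

Pure glue: a strict hcp certificate (`StrictCertificate`, fourteen conjuncts on a witness
`⟨P, ρ, c, g, U, f⟩`) is in particular an exact three-cone certificate (`ExactCertificate`):
keep the same witness, forget the hcp-template description of `P` (conjunct 1) and the six
strictness conjuncts (8–14); conjuncts 2–7 are verbatim the body of `ExactCertificate`.
No mathematics beyond projection. [folklore]
-/

namespace Summit.AtomisticToContinuum.Crystallization.Theorems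

open Summit.AtomisticToContinuum.Crystallization.Theses.BraggSlacknessRigidity

/-- **`StrictImpliesExact` holds** (item stmt-AtomisticToContinuum-13169 of route
`BraggSlacknessRigidity`): `StrictCertificate → ExactCertificate`, by projecting the strict
certificate's witness `⟨P, ρ, c, g, U, f⟩` onto its conjuncts 2–7 (drop the hcp-template clause
and the six strictness clauses). [folklore] -/
theorem strictImpliesExact_proof : StrictImpliesExact := by
  unfold StrictImpliesExact StrictCertificate ExactCertificate
  rintro ⟨P, ρ, c, g, U, f, -, h₁, h₂, h₃, h₄, h₅, h₆, -⟩
  exact ⟨P, ρ, c, g, U, f, h₁, h₂, h₃, h₄, h₅, h₆⟩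

end Summit.AtomisticToContinuum.Crystallization.Theorems
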